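import Literature.NumberTheory.ConnesConsani2021.SchwartzKernelsHSKernel
import Literature.NumberTheory.ConnesConsani2021.CutoffProjHatSincKernel
import Literature.NumberTheory.ConnesConsani2021.CutoffScalingKernelTrace
import Literature.Analysis.FunctionSpaces.PlancherelL1L2
import HarnessLib

/-!
# Connes–Consani 2021, Prop. 2.2 (iii) discharge (R49/R58), step A2–A3:
# the `L²` kernel of `𝓕 P̂ P ϑ(g) = P 𝓕 P ϑ(g) E` and the reduction of `CC2021_prop_2_2_iii`
# to ONE kernel-energy identity (RH-FREE)

A. Connes, C. Consani, *Weil positivity and trace formula, the archimedean place*, Selecta Math. (N.S.)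
27 (2021) 77 = arXiv:2006.13771 [bib: `ConnesConsani2021`], §2 Prop. 2.2 (iii) (= arXiv Prop. 10 (iii))
p. 10: "`Tr(ϑ(f)PP̂P) = ∫ f(ρ⁻¹)(δ(ρ) − τ(ρ))d*ρ`", typed in the tree as the named fact
`CC2021_prop_2_2_iii` (`SchwartzKernels.lean`; for `f = g ∗ g*` the trace is the Hilbert–Schmidt norm
`‖P̂Pϑ(g)‖²_HS`).  Cell `rh-crit`, sub-cell `cc/`, seat gm-t15 (lead writer of the discharge, cc-lead R58);
co-seats t1 (`SchwartzKernelsHSKernel.lean`: the kernel `k_g` of `ϑ(g)` and `κ_g = k_g^{ev}` of `ϑ(g)E`,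
imported here) and gm-t13 (the scalar energy identity, `CosineTailEnergy.lean`).

## What this file does (the printed proof's kernel bookkeeping, p. 10, in the `L²(ℝ)` picture)

With `P = 1_{|x| ≥ 1}` (`cutoffP`, `𝐏₁₀ = PE = soninProjection 1 0`), `P̂ = 𝓕⁻¹P𝓕`
(`𝐏₀₁ = P̂E = soninProjection 0 1`) and Mathlib's unitary `𝓕` on `L²(ℝ)` (so `𝓕P̂ = P𝓕`):

* `cutoffEvenScalingKernel g x y = 1_{|x| ≥ 1} κ_g(x,y)` — the kernel of `Pϑ(g)E = 𝐏₁₀ϑ(g)`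
  (`soninProjection_scalingOp_toLp_coeFn`, from t1's `scalingOp_coeFn_even_part` and gm-t14's
  `soninProjection_one_zero_coeFn`);
* `cutoffScalingKernel g ξ y = 1_{|ξ| ≥ 1} ∫ e^{−2πixξ} 1_{|x|≥1} κ_g(x,y) dx` — **the kernel of
  `T_g := 𝓕 𝐏₀₁ 𝐏₁₀ ϑ(g) = P𝓕Pϑ(g)E`**: for continuous compactly supported `φ₀`,
  `𝓕(𝐏₀₁𝐏₁₀ϑ(g)φ₀)(ξ) = ∫ k_g(ξ,y)φ₀(y)dy` a.e. (`fourier_cutoffs_scalingOp_toLp_coeFn`: `Pϑ(g)Eφ₀` is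
  bounded with compact support, so its `L²` Fourier transform is the Fourier integral
  (`PlancherelL1L2.fourier_toLp_ae_eq_fourierIntegral`) and Fubini applies; `𝓕P̂ = P𝓕` on the even
  function `𝐏₁₀ϑ(g)φ₀` via `soninProjection_zero_one_eq_outerProjHat`), and then for EVERY `φ ∈ L²(ℝ)`
  as soon as the kernel is square integrable (`fourier_cutoffs_scalingOp_coeFn`: both sides are bounded
  operators — the right one by Reed–Simon VI.23, `L2Kernel.exists_op` — agreeing on the dense subspace
  `C_c(ℝ)`, `MemLp.exists_hasCompactSupport_eLpNorm_sub_le`);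
* **`CC2021_prop_2_2_iii_of_kernel_energy`**: by the operator half (`CutoffScalingKernelTrace.lean`,
  socket `prop_2_2_iii_of_l2Kernel` with the isometry `U = 𝓕`), `CC2021_prop_2_2_iii` follows from the
  single KERNEL-ENERGY IDENTITY "`k_g ∈ L²(ℝ²)` and `∫∫ |k_g(ξ,y)|² dy dξ = Re L(g ∗ g*)`" for every test
  function `g` — the content of the printed proof (Prop. 1.5, Lemma 1.4 (iii), Prop. 2.2 (i)–(iii)),
  delivered by the cell as `CosineTailEnergy` (the substitution `x = e^v/ξ` turns the column
  `∫_{|x|≥1} e^{−2πixξ}κ_g(x,y)dx` into `(|ξ||y|)^{-1/2} ∫_{v ≥ log|ξ|} g(v − log|ξ| − log|y|) e^{v/2}cos(2πe^v) dv`).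

Theorems + two definitions with bodies; no named fact, no instance, no `sorry`.  Net debt delta 0.
bears_on: W-C/W-P (K1 boundary fact `CC2021_prop_2_2_iii`).  WHAT THIS IS NOT: any claim about RH —
kernel bookkeeping for an archimedean Hilbert–Schmidt operator; nothing here bears on the truth of RH.

## References
* A. Connes, C. Consani, Selecta Math. (N.S.) 27 (2021) 77 = arXiv:2006.13771, §1 Lemma 1.1, Remark 1.2
  (kernels, even restriction) p. 7; §2 Prop. 2.2 (iii) and its proof p. 10 (chunk p0010:L20–L75).
  [ConnesConsani2021]
* M. Reed, B. Simon, *Methods of Modern Mathematical Physics I* (1972), Thm. VI.23 (PDF pp. 198–199).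
  [ReedSimon1972]
-/

noncomputable section

open MeasureTheory Complex Set Filter Function
open scoped Real ComplexConjugate ENNReal InnerProductSpace Topology FourierTransform

namespace Literature.NumberTheory.ConnesConsani2021

open Literature.NumberTheory.LFunctions Literature.Analysis.OperatorTheory

variable {g : ℝ → ℂ}

/-! ## The kernels of `Pϑ(g)E` and of `P𝓕Pϑ(g)E` -/

/-- **The kernel of `Pϑ(g)E = 𝐏₁₀ϑ(g)`**: `1_{|x| ≥ 1} κ_g(x, y)` with t1's symmetrised kernel
`κ_g(x,y) = ½ g(log(|x|/|y|)) |xy|^{-1/2}` (`evenScalingKernel`; Remark 1.2: the even restriction has kernel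
`½(k(x,y) + k(x,−y))`, and `P` multiplies by the characteristic function of `|x| ≥ 1`).
[cite: ConnesConsani2021, §1 Remark 1.2 p. 7 (arXiv Remark 5); §2 Prop. 2.2 (iii) proof p. 10] -/
def cutoffEvenScalingKernel (g : ℝ → ℂ) (x y : ℝ) : ℂ :=
  if 1 ≤ |x| then evenScalingKernel g x y else 0

/-- **The kernel of `T_g = 𝓕 𝐏₀₁ 𝐏₁₀ ϑ(g) = P 𝓕 P ϑ(g) E`** on `L²(ℝ)` (Mathlib's `𝓕`, kernel `e^{−2πixξ}`):
`k_g(ξ, y) = 1_{|ξ| ≥ 1} ∫ e^{−2πixξ} 1_{|x| ≥ 1} κ_g(x, y) dx` — the Fourier transform in `x` of the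
compactly supported bounded column `x ↦ 1_{|x|≥1}κ_g(x,y)`, cut off at `|ξ| ≥ 1`.
[cite: ConnesConsani2021, §2 Prop. 2.2 (iii) proof p. 10 (kernel of `(1 − P)(u^g)P`, chunk p0010:L28–L40)] -/
def cutoffScalingKernel (g : ℝ → ℂ) (ξ y : ℝ) : ℂ :=
  if 1 ≤ |ξ| then ∫ x : ℝ, cexp (↑(-2 * π * x * ξ) * I) * cutoffEvenScalingKernel g x y else 0

/-- Off the cutoff the kernel of `Pϑ(g)E` vanishes. [cite: ConnesConsani2021, §2 Prop. 2.2 (iii) proof p. 10] -/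
theorem cutoffEvenScalingKernel_of_lt {x : ℝ} (hx : |x| < 1) (y : ℝ) :
    cutoffEvenScalingKernel g x y = 0 := by
  simp [cutoffEvenScalingKernel, not_le.mpr hx]

/-- On the cutoff the kernel of `Pϑ(g)E` is `κ_g`. [cite: ConnesConsani2021, §2 Prop. 2.2 (iii) proof p. 10] -/
theorem cutoffEvenScalingKernel_of_le {x : ℝ} (hx : 1 ≤ |x|) (y : ℝ) :
    cutoffEvenScalingKernel g x y = evenScalingKernel g x y := by
  simp [cutoffEvenScalingKernel, hx]

/-- Off the cutoff `|ξ| ≥ 1` the kernel of `T_g` vanishes. [cite: ConnesConsani2021, §2 Prop. 2.2 (iii) proof p. 10] -/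
theorem cutoffScalingKernel_of_lt {ξ : ℝ} (hξ : |ξ| < 1) (y : ℝ) : cutoffScalingKernel g ξ y = 0 := by
  simp [cutoffScalingKernel, not_le.mpr hξ]

/-- On `|ξ| ≥ 1` the kernel of `T_g` is the Fourier integral of the column of `Pϑ(g)E`.
[cite: ConnesConsani2021, §2 Prop. 2.2 (iii) proof p. 10] -/
theorem cutoffScalingKernel_of_le {ξ : ℝ} (hξ : 1 ≤ |ξ|) (y : ℝ) :
    cutoffScalingKernel g ξ y = ∫ x : ℝ, cexp (↑(-2 * π * x * ξ) * I) * cutoffEvenScalingKernel g x y := by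
  simp [cutoffScalingKernel, hξ]

/-! ## Measurability -/

/-- t1's kernel `k_g` is jointly measurable (for measurable `g`). [cite: ConnesConsani2021, §4 eq. (40) p. 15] -/
theorem measurable_scalingKernel (hg : Measurable g) : Measurable (uncurry (scalingKernel g)) := by
  have h1 : Measurable fun p : ℝ × ℝ =>
      g (Real.log (p.1 / p.2)) * (((Real.sqrt (p.1 * p.2))⁻¹ : ℝ) : ℂ) :=
    (hg.comp (measurable_fst.div measurable_snd).log).mul
      (measurable_ofReal.comp (measurable_fst.mul measurable_snd).sqrt.inv)
  have h : uncurry (scalingKernel g) = fun p : ℝ × ℝ =>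
      if 0 < p.1 * p.2 then g (Real.log (p.1 / p.2)) * (((Real.sqrt (p.1 * p.2))⁻¹ : ℝ) : ℂ) else 0 := by
    funext p
    rfl
  rw [h]
  exact Measurable.ite (measurableSet_lt measurable_const (measurable_fst.mul measurable_snd)) h1
    measurable_const

/-- The symmetrised kernel `κ_g` is jointly measurable. [cite: ConnesConsani2021, §1 Remark 1.2 p. 7] -/
theorem measurable_evenScalingKernel (hg : Measurable g) : Measurable (uncurry (evenScalingKernel g)) := by
  have h1 := measurable_scalingKernel hg
  have h2 : Measurable fun p : ℝ × ℝ => scalingKernel g (-p.1) p.2 :=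
    h1.comp (measurable_fst.neg.prodMk measurable_snd)
  have h : uncurry (evenScalingKernel g) = fun p : ℝ × ℝ =>
      (1 / 2 : ℂ) * (scalingKernel g p.1 p.2 + scalingKernel g (-p.1) p.2) := by
    funext p
    rfl
  rw [h]
  exact (h1.add h2).const_mul _

/-- The kernel of `Pϑ(g)E` is jointly measurable. [cite: ConnesConsani2021, §2 Prop. 2.2 (iii) proof p. 10] -/
theorem measurable_cutoffEvenScalingKernel (hg : Measurable g) :
    Measurable (uncurry (cutoffEvenScalingKernel g)) := by
  have h : uncurry (cutoffEvenScalingKernel g) = fun p : ℝ × ℝ =>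
      if 1 ≤ |p.1| then evenScalingKernel g p.1 p.2 else 0 := by
    funext p
    rfl
  rw [h]
  exact Measurable.ite (measurableSet_le measurable_const (continuous_abs.measurable.comp measurable_fst))
    (measurable_evenScalingKernel hg) measurable_const

/-- The Fourier integrand `((ξ, y), x) ↦ e^{−2πixξ} 1_{|x|≥1}κ_g(x,y)` is jointly measurable.
[cite: ConnesConsani2021, §2 Prop. 2.2 (iii) proof p. 10] -/
theorem measurable_fourierIntegrand_cutoffEvenScalingKernel (hg : Measurable g) :
    Measurable fun q : (ℝ × ℝ) × ℝ =>
      cexp (↑(-2 * π * q.2 * q.1.1) * I) * cutoffEvenScalingKernel g q.2 q.1.2 := by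
  refine Measurable.mul ?_ ((measurable_cutoffEvenScalingKernel hg).comp
    (measurable_snd.prodMk (measurable_snd.comp measurable_fst)))
  refine Complex.measurable_exp.comp ((measurable_ofReal.comp ?_).mul_const I)
  exact ((measurable_const.mul measurable_snd).mul (measurable_fst.comp measurable_fst))

/-- **The kernel `k_g` of `T_g` is jointly measurable.** [cite: ConnesConsani2021, §2 Prop. 2.2 (iii) proof p. 10] -/
theorem measurable_cutoffScalingKernel (hg : Measurable g) : Measurable (uncurry (cutoffScalingKernel g)) := by
  have hI : StronglyMeasurable fun p : ℝ × ℝ =>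
      ∫ x : ℝ, cexp (↑(-2 * π * x * p.1) * I) * cutoffEvenScalingKernel g x p.2 :=
    (measurable_fourierIntegrand_cutoffEvenScalingKernel hg).stronglyMeasurable.integral_prod_right'
  have h : uncurry (cutoffScalingKernel g) = fun p : ℝ × ℝ =>
      if 1 ≤ |p.1| then ∫ x : ℝ, cexp (↑(-2 * π * x * p.1) * I) * cutoffEvenScalingKernel g x p.2
      else 0 := by
    funext p
    rfl
  rw [h]
  exact Measurable.ite (measurableSet_le measurable_const (continuous_abs.measurable.comp measurable_fst))
    hI.measurable measurable_const

/-- `k_g` is a.e.-strongly measurable on `ℝ × ℝ`. [cite: ConnesConsani2021, §2 Prop. 2.2 (iii) proof p. 10] -/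
theorem aestronglyMeasurable_cutoffScalingKernel (hg : Measurable g) :
    AEStronglyMeasurable (uncurry (cutoffScalingKernel g)) ((volume : Measure ℝ).prod volume) :=
  (measurable_cutoffScalingKernel hg).aestronglyMeasurable

/-! ## Bounds and support of the kernel of `Pϑ(g)E` (for `g` bounded with support in `(−T, T)`) -/

/-- **Uniform bound on the cutoff**: if `|g| ≤ M` and `g` vanishes off `(−T, T)`, then for `|v| ≥ 1`,
`|k_g(v, y)| ≤ M e^{T/2}` (on the support `v/y < e^T`, so `vy = v²/(v/y) > e^{−T}`).
[cite: ConnesConsani2021, §4 eq. (40) p. 15; §2 Prop. 2.2 (iii) proof p. 10] -/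
theorem norm_scalingKernel_le {M T : ℝ} (hM : ∀ t, ‖g t‖ ≤ M) (hT : ∀ t, T ≤ |t| → g t = 0)
    {v : ℝ} (hv : 1 ≤ |v|) (y : ℝ) : ‖scalingKernel g v y‖ ≤ M * Real.exp (T / 2) := by
  have hM0 : 0 ≤ M := (norm_nonneg _).trans (hM 0)
  have hMT : 0 ≤ M * Real.exp (T / 2) := mul_nonneg hM0 (Real.exp_pos _).le
  by_cases h : 0 < v * y
  · rw [scalingKernel_of_pos h]
    by_cases hz : g (Real.log (v / y)) = 0
    · rw [hz, zero_mul, norm_zero]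
      exact hMT
    · have hv0 : v ≠ 0 := fun h0 => by rw [h0, zero_mul] at h; exact lt_irrefl _ h
      have hy0 : y ≠ 0 := fun h0 => by rw [h0, mul_zero] at h; exact lt_irrefl _ h
      have hq : 0 < v / y := by
        have : v / y = v * y / y ^ 2 := by field_simp
        rw [this]; positivity
      have hlt : |Real.log (v / y)| < T := by
        by_contra hle
        exact hz (hT _ (not_lt.mp hle))
      have hqT : v / y < Real.exp T := by
        rw [← Real.log_lt_iff_lt_exp hq]
        exact (abs_lt.mp hlt).2
      have hvy : Real.exp (-T) < v * y := by
        have h1 : v * y = v ^ 2 / (v / y) := by field_simp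
        have h2 : 1 ≤ v ^ 2 := by nlinarith [abs_nonneg v, sq_abs v]
        rw [h1, Real.exp_neg, lt_div_iff₀ hq]
        calc (Real.exp T)⁻¹ * (v / y) < (Real.exp T)⁻¹ * Real.exp T :=
              mul_lt_mul_of_pos_left hqT (inv_pos.mpr (Real.exp_pos T))
          _ = 1 := inv_mul_cancel₀ (Real.exp_pos T).ne'
          _ ≤ v ^ 2 := h2
      have hsqrt : Real.exp (-(T / 2)) ≤ Real.sqrt (v * y) := by
        rw [show (-(T / 2) : ℝ) = -T / 2 by ring, Real.exp_half]
        exact Real.sqrt_le_sqrt hvy.le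
      have hinv : (Real.sqrt (v * y))⁻¹ ≤ Real.exp (T / 2) :=
        (inv_anti₀ (Real.exp_pos _) hsqrt).trans_eq (by rw [Real.exp_neg, inv_inv])
      rw [norm_mul, Complex.norm_real, Real.norm_eq_abs,
        abs_of_nonneg (inv_nonneg.mpr (Real.sqrt_nonneg _))]
      exact mul_le_mul (hM _) hinv (inv_nonneg.mpr (Real.sqrt_nonneg _)) hM0
  · rw [scalingKernel_of_not_pos h, norm_zero]
    exact hMT

/-- **Uniform bound** `|1_{|x|≥1}κ_g(x,y)| ≤ M e^{T/2}`. [cite: ConnesConsani2021, §2 Prop. 2.2 (iii) proof p. 10] -/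
theorem norm_cutoffEvenScalingKernel_le {M T : ℝ} (hM : ∀ t, ‖g t‖ ≤ M) (hT : ∀ t, T ≤ |t| → g t = 0)
    (x y : ℝ) : ‖cutoffEvenScalingKernel g x y‖ ≤ M * Real.exp (T / 2) := by
  have hM0 : 0 ≤ M := (norm_nonneg _).trans (hM 0)
  have hMT : 0 ≤ M * Real.exp (T / 2) := mul_nonneg hM0 (Real.exp_pos _).le
  by_cases hx : 1 ≤ |x|
  · rw [cutoffEvenScalingKernel_of_le hx]
    have hx' : 1 ≤ |(-x)| := by rwa [abs_neg]
    unfold evenScalingKernel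
    calc ‖(1 / 2 : ℂ) * (scalingKernel g x y + scalingKernel g (-x) y)‖
        ≤ ‖(1 / 2 : ℂ)‖ * (‖scalingKernel g x y‖ + ‖scalingKernel g (-x) y‖) := by
          rw [norm_mul]; gcongr; exact norm_add_le _ _
      _ ≤ (1 / 2) * (M * Real.exp (T / 2) + M * Real.exp (T / 2)) := by
          rw [show ‖(1 / 2 : ℂ)‖ = 1 / 2 by simp]
          gcongr
          · exact norm_scalingKernel_le hM hT hx y
          · exact norm_scalingKernel_le hM hT hx' y
      _ = M * Real.exp (T / 2) := by ring
  · rw [cutoffEvenScalingKernel_of_lt (not_le.mp hx), norm_zero]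
    exact hMT

/-- **Support in `x`**: if `g` vanishes off `(−T, T)` then `1_{|x|≥1}κ_g(x,y) = 0` as soon as
`|y| e^T < |x|` (the scale ratio `|x|/|y|` leaves the support of `g ∘ log`).
[cite: ConnesConsani2021, §2 Prop. 2.2 (iii) proof p. 10] -/
theorem cutoffEvenScalingKernel_eq_zero_of_lt {T : ℝ} (hT : ∀ t, T ≤ |t| → g t = 0) {x y : ℝ}
    (hxy : |y| * Real.exp T < |x|) : cutoffEvenScalingKernel g x y = 0 := by
  by_cases hx : 1 ≤ |x|
  · rw [cutoffEvenScalingKernel_of_le hx]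
    -- each of the two one-sided kernels vanishes
    have key : ∀ v : ℝ, |v| = |x| → scalingKernel g v y = 0 := by
      intro v hv
      by_cases h : 0 < v * y
      · rw [scalingKernel_of_pos h]
        have hy0 : y ≠ 0 := fun h0 => by rw [h0, mul_zero] at h; exact lt_irrefl _ h
        have hq : 0 < v / y := by
          have : v / y = v * y / y ^ 2 := by field_simp
          rw [this]; positivity
        have hqabs : v / y = |x| / |y| := by rw [← hv, ← abs_div, abs_of_pos hq]
        have hypos : 0 < |y| := abs_pos.mpr hy0
        have hgt : Real.exp T < v / y := by
          rw [hqabs, lt_div_iff₀ hypos]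
          linarith [mul_comm (|y|) (Real.exp T)]
        have hlog : T < Real.log (v / y) := by
          rw [Real.lt_log_iff_exp_lt hq]
          exact hgt
        rw [hT _ (hlog.le.trans (le_abs_self _)), zero_mul]
      · exact scalingKernel_of_not_pos h
    unfold evenScalingKernel
    rw [key x rfl, key (-x) (abs_neg x), add_zero, mul_zero]
  · exact cutoffEvenScalingKernel_of_lt (not_le.mp hx) y

/-! ## The column `x ↦ ∫ 1_{|x|≥1}κ_g(x,y)φ₀(y)dy` of a continuous compactly supported `φ₀` -/

/-- Outside `[−R, R]` one has `R < |x|`. [folklore] -/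
private theorem lt_abs_of_not_mem_Icc {R x : ℝ} (h : x ∉ Icc (-R) R) : R < |x| := by
  simp only [mem_Icc, not_and_or, not_le] at h
  rcases h with h | h
  · calc R < -x := by linarith
      _ ≤ |x| := neg_le_abs x
  · exact h.trans_le (le_abs_self x)

/-- A bounded, a.e.-strongly measurable function vanishing off a bounded interval is integrable. [folklore] -/
private theorem integrable_of_norm_le_of_eq_zero {E : Type*} [NormedAddCommGroup E] {f : ℝ → E}
    (hf : AEStronglyMeasurable f volume) {M R : ℝ} (hM : ∀ x, ‖f x‖ ≤ M)
    (hR : ∀ x, R < |x| → f x = 0) : Integrable f volume := by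
  have hs : IntegrableOn f (Icc (-R) R) volume :=
    Measure.integrableOn_of_bounded (by rw [Real.volume_Icc]; exact ENNReal.ofReal_ne_top) hf
      (ae_of_all _ fun x => hM x)
  exact hs.integrable_of_forall_notMem_eq_zero fun x hx => hR x (lt_abs_of_not_mem_Icc hx)

/-- … and square integrable. [folklore] -/
private theorem memLp_two_of_norm_le_of_eq_zero {f : ℝ → ℂ} (hf : AEStronglyMeasurable f volume)
    {M R : ℝ} (hM : ∀ x, ‖f x‖ ≤ M) (hR : ∀ x, R < |x| → f x = 0) : MemLp f 2 volume := by
  rw [memLp_two_iff_integrable_sq_norm hf]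
  refine integrable_of_norm_le_of_eq_zero ((continuous_pow 2).comp_aestronglyMeasurable hf.norm)
    (M := M ^ 2) (R := R) (fun x => ?_) (fun x hx => by simp [hR x hx])
  rw [Real.norm_eq_abs, abs_pow, abs_norm]
  exact pow_le_pow_left₀ (norm_nonneg _) (hM x) 2

/-- The column `x ↦ ∫ 1_{|x|≥1}κ_g(x,y) φ₀(y) dy` is strongly measurable.
[cite: ConnesConsani2021, §2 Prop. 2.2 (iii) proof p. 10] -/
theorem stronglyMeasurable_integral_cutoffEvenScalingKernel_mul (hg : Measurable g) {φ₀ : ℝ → ℂ}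
    (hφ : Measurable φ₀) :
    StronglyMeasurable fun x => ∫ y, cutoffEvenScalingKernel g x y * φ₀ y := by
  have h : Measurable (uncurry fun x y => cutoffEvenScalingKernel g x y * φ₀ y) :=
    (measurable_cutoffEvenScalingKernel hg).mul (hφ.comp measurable_snd)
  exact h.stronglyMeasurable.integral_prod_right

/-- **The column of `Pϑ(g)E` against a continuous compactly supported `φ₀` is bounded and compactly
supported**: `|∫ 1_{|x|≥1}κ_g(x,y)φ₀(y)dy| ≤ M e^{T/2}‖φ₀‖₁`, and the integrand vanishes identically for
`|x| > R e^T` (`supp φ₀ ⊂ [−R, R]`, `supp g ⊂ (−T, T)`). [cite: ConnesConsani2021, §2 Prop. 2.2 (iii) proof p. 10] -/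
theorem exists_bound_support_column (hg : Continuous g) (hgs : HasCompactSupport g)
    {φ₀ : ℝ → ℂ} (hφc : Continuous φ₀) (hφs : HasCompactSupport φ₀) :
    ∃ C R : ℝ, (∀ x, ‖∫ y, cutoffEvenScalingKernel g x y * φ₀ y‖ ≤ C) ∧
      (∀ x, R < |x| → ∀ y, cutoffEvenScalingKernel g x y * φ₀ y = 0) := by
  obtain ⟨M, hM⟩ := hg.bounded_above_of_compact_support hgs
  obtain ⟨T, -, hT⟩ := hgs.exists_pos_le_norm
  obtain ⟨R, -, hR⟩ := hφs.exists_pos_le_norm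
  have hT' : ∀ t, T ≤ |t| → g t = 0 := fun t ht => hT t (by simpa using ht)
  have hφi : Integrable φ₀ := hφc.integrable_of_hasCompactSupport hφs
  refine ⟨M * Real.exp (T / 2) * ∫ y, ‖φ₀ y‖, R * Real.exp T, fun x => ?_, fun x hx y => ?_⟩
  · calc ‖∫ y, cutoffEvenScalingKernel g x y * φ₀ y‖
        ≤ ∫ y, ‖cutoffEvenScalingKernel g x y * φ₀ y‖ := norm_integral_le_integral_norm _
      _ ≤ ∫ y, M * Real.exp (T / 2) * ‖φ₀ y‖ := by
          refine integral_mono_of_nonneg (ae_of_all _ fun y => norm_nonneg _) (hφi.norm.const_mul _)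
            (ae_of_all _ fun y => ?_)
          simp only [norm_mul]
          exact mul_le_mul_of_nonneg_right (norm_cutoffEvenScalingKernel_le hM hT' x y) (norm_nonneg _)
      _ = M * Real.exp (T / 2) * ∫ y, ‖φ₀ y‖ := integral_const_mul _ _
  · by_cases hy : R ≤ |y|
    · rw [hR y (by simpa using hy), mul_zero]
    · rw [cutoffEvenScalingKernel_eq_zero_of_lt hT' ?_, zero_mul]
      calc |y| * Real.exp T < R * Real.exp T := mul_lt_mul_of_pos_right (not_le.mp hy) (Real.exp_pos T)
        _ < |x| := hx

/-- **`𝐏₁₀ ϑ(g) φ₀ = Pϑ(g)Eφ₀` acts by the kernel `1_{|x|≥1}κ_g`** (t1's `scalingOp_coeFn_even_part` and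
gm-t14's `soninProjection_one_zero_coeFn`): for `φ₀ ∈ L²`,
`(𝐏₁₀ϑ(g)φ₀)(x) = ∫ 1_{|x|≥1}κ_g(x,y)φ₀(y)dy` a.e.
[cite: ConnesConsani2021, §1 Remark 1.2 p. 7; §2 Prop. 2.2 (iii) proof p. 10] -/
theorem soninProjection_scalingOp_toLp_coeFn (hg : Continuous g) (hgs : HasCompactSupport g)
    {φ₀ : ℝ → ℂ} (hφ : MemLp φ₀ 2 (volume : Measure ℝ)) :
    (soninProjection 1 0 (scalingOp g (hφ.toLp φ₀)) : ℝ → ℂ) =ᵐ[volume]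
      fun x => ∫ y, cutoffEvenScalingKernel g x y * φ₀ y := by
  have h1 := soninProjection_one_zero_coeFn (scalingOp g (hφ.toLp φ₀))
  have h2 := scalingOp_coeFn_even_part hg hgs (hφ.toLp φ₀)
  have h3 : ∀ x, ∫ y, evenScalingKernel g x y * (hφ.toLp φ₀ : ℝ → ℂ) y
      = ∫ y, evenScalingKernel g x y * φ₀ y := fun x =>
    integral_congr_ae (by filter_upwards [hφ.coeFn_toLp] with y hy; rw [hy])
  filter_upwards [h1, h2] with x hx1 hx2
  rw [hx1, cutoffP]
  by_cases hx : 1 ≤ |x|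
  · rw [if_pos hx]
    simp only [cutoffEvenScalingKernel_of_le hx]
    rw [← h3 x, ← hx2]
    norm_num
  · rw [if_neg hx]
    simp only [cutoffEvenScalingKernel_of_lt (not_le.mp hx), zero_mul, integral_zero]

/-- **Fubini for the column**: `∫ e^{−2πixξ} (∫ 1_{|x|≥1}κ_g(x,y)φ₀(y)dy) dx = ∫ (∫ e^{−2πixξ}1_{|x|≥1}κ_g(x,y)dx) φ₀(y) dy`
for continuous compactly supported `φ₀` (the integrand is bounded with compact support in `(x, y)`).
[cite: ConnesConsani2021, §2 Prop. 2.2 (iii) proof p. 10] -/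
theorem fourierIntegral_column_eq (hg : Continuous g) (hgs : HasCompactSupport g)
    {φ₀ : ℝ → ℂ} (hφc : Continuous φ₀) (hφs : HasCompactSupport φ₀) (ξ : ℝ) :
    ∫ x, cexp (↑(-2 * π * x * ξ) * I) * ∫ y, cutoffEvenScalingKernel g x y * φ₀ y
      = ∫ y, (∫ x, cexp (↑(-2 * π * x * ξ) * I) * cutoffEvenScalingKernel g x y) * φ₀ y := by
  obtain ⟨M, hM⟩ := hg.bounded_above_of_compact_support hgs
  obtain ⟨T, -, hT⟩ := hgs.exists_pos_le_norm
  obtain ⟨R, -, hR⟩ := hφs.exists_pos_le_norm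
  obtain ⟨Cφ, hCφ⟩ := hφc.bounded_above_of_compact_support hφs
  have hT' : ∀ t, T ≤ |t| → g t = 0 := fun t ht => hT t (by simpa using ht)
  have hM0 : 0 ≤ M := (norm_nonneg _).trans (hM 0)
  set G : ℝ × ℝ → ℂ := fun p =>
    cexp (↑(-2 * π * p.1 * ξ) * I) * (cutoffEvenScalingKernel g p.1 p.2 * φ₀ p.2) with hG
  have hGm : AEStronglyMeasurable G ((volume : Measure ℝ).prod volume) := by
    refine (Measurable.mul ?_ ((measurable_cutoffEvenScalingKernel hg.measurable).mul
      (hφc.measurable.comp measurable_snd))).aestronglyMeasurable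
    exact Complex.measurable_exp.comp ((measurable_ofReal.comp
      ((measurable_const.mul measurable_fst).mul measurable_const)).mul_const I)
  have hGbdd : ∀ p, ‖G p‖ ≤ M * Real.exp (T / 2) * Cφ := by
    intro p
    simp only [hG, norm_mul, Complex.norm_exp_ofReal_mul_I, one_mul]
    exact mul_le_mul (norm_cutoffEvenScalingKernel_le hM hT' _ _) (hCφ _) (norm_nonneg _)
      (mul_nonneg hM0 (Real.exp_pos _).le)
  have hGsupp : ∀ p, p ∉ Icc (-(R * Real.exp T)) (R * Real.exp T) ×ˢ Icc (-R) R → G p = 0 := by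
    intro p hp
    rw [Set.mem_prod, not_and_or] at hp
    simp only [hG]
    rcases hp with h | h
    · have h1 : R * Real.exp T < |p.1| := lt_abs_of_not_mem_Icc h
      by_cases hy : R ≤ |p.2|
      · rw [hR _ (by simpa using hy), mul_zero, mul_zero]
      · rw [cutoffEvenScalingKernel_eq_zero_of_lt hT'
          (lt_trans (mul_lt_mul_of_pos_right (not_le.mp hy) (Real.exp_pos T)) h1), zero_mul, mul_zero]
    · rw [hR _ (by simpa using (lt_abs_of_not_mem_Icc h).le), mul_zero, mul_zero]
  have hGint : Integrable G ((volume : Measure ℝ).prod volume) := by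
    have hs : IntegrableOn G (Icc (-(R * Real.exp T)) (R * Real.exp T) ×ˢ Icc (-R) R)
        ((volume : Measure ℝ).prod volume) :=
      Measure.integrableOn_of_bounded (by
          rw [Measure.prod_prod, Real.volume_Icc, Real.volume_Icc]
          exact ENNReal.mul_ne_top ENNReal.ofReal_ne_top ENNReal.ofReal_ne_top)
        hGm (ae_of_all _ fun p => hGbdd p)
    exact hs.integrable_of_forall_notMem_eq_zero hGsupp
  calc ∫ x, cexp (↑(-2 * π * x * ξ) * I) * ∫ y, cutoffEvenScalingKernel g x y * φ₀ y
      = ∫ x, ∫ y, G (x, y) := by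
        refine integral_congr_ae (ae_of_all _ fun x => ?_)
        simp only [hG]
        exact (integral_const_mul _ _).symm
    _ = ∫ y, ∫ x, G (x, y) := integral_integral_swap hGint
    _ = ∫ y, (∫ x, cexp (↑(-2 * π * x * ξ) * I) * cutoffEvenScalingKernel g x y) * φ₀ y := by
        refine integral_congr_ae (ae_of_all _ fun y => ?_)
        simp only [hG]
        rw [← integral_mul_const]
        refine integral_congr_ae (ae_of_all _ fun x => ?_)
        simp only
        ring

/-! ## `𝓕 𝐏₀₁ 𝐏₁₀ ϑ(g)` acts by the kernel `k_g` -/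

/-- **The kernel of `T_g = 𝓕 𝐏₀₁ 𝐏₁₀ ϑ(g)` on continuous compactly supported functions**: for
`φ₀ ∈ C_c(ℝ)`, `𝓕(𝐏₀₁𝐏₁₀ϑ(g)φ₀)(ξ) = ∫ k_g(ξ,y) φ₀(y) dy` for a.e. `ξ` (the printed kernel of
`(1 − P)(u^g)Pϑ`, in the `L²(ℝ)` picture: `𝐏₁₀ϑ(g)φ₀` is bounded with compact support, its `L²` Fourier
transform is the Fourier integral, Fubini, and `𝓕P̂ = P𝓕` on the even function `𝐏₁₀ϑ(g)φ₀`).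
[cite: ConnesConsani2021, §2 Prop. 2.2 (iii) proof p. 10 (chunk p0010:L28–L40)] -/
theorem fourier_cutoffs_scalingOp_toLp_coeFn (hg : Continuous g) (hgs : HasCompactSupport g)
    {φ₀ : ℝ → ℂ} (hφc : Continuous φ₀) (hφs : HasCompactSupport φ₀) :
    ((𝓕 (soninProjection 0 1 (soninProjection 1 0 (scalingOp g
        ((hφc.memLp_of_hasCompactSupport (μ := (volume : Measure ℝ)) (p := 2) hφs).toLp φ₀)))) :
          Lp ℂ 2 (volume : Measure ℝ)) : ℝ → ℂ)
      =ᵐ[volume] fun ξ => ∫ y, cutoffScalingKernel g ξ y * φ₀ y := by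
  set φ : Lp ℂ 2 (volume : Measure ℝ) :=
    (hφc.memLp_of_hasCompactSupport (μ := (volume : Measure ℝ)) (p := 2) hφs).toLp φ₀ with hφdef
  set w : Lp ℂ 2 (volume : Measure ℝ) := soninProjection 1 0 (scalingOp g φ) with hwdef
  set cφ : ℝ → ℂ := fun x => ∫ y, cutoffEvenScalingKernel g x y * φ₀ y with hcφ
  -- (1) `w = cφ` a.e.
  have h1 : (w : ℝ → ℂ) =ᵐ[volume] cφ := soninProjection_scalingOp_toLp_coeFn hg hgs _
  -- (2) `cφ ∈ L¹ ∩ L²`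
  have hmeas : AEStronglyMeasurable cφ volume :=
    (stronglyMeasurable_integral_cutoffEvenScalingKernel_mul hg.measurable
      hφc.measurable).aestronglyMeasurable
  obtain ⟨C, R, hC, hR⟩ := exists_bound_support_column hg hgs hφc hφs
  have hR' : ∀ x, R < |x| → cφ x = 0 := fun x hx =>
    (integral_congr_ae (Eventually.of_forall (hR x hx))).trans (integral_zero _ _)
  have hint : Integrable cφ volume := integrable_of_norm_le_of_eq_zero hmeas hC hR'
  have hmem : MemLp cφ 2 volume := memLp_two_of_norm_le_of_eq_zero hmeas hC hR'
  -- (3) `w = toLp cφ`, so `𝓕 w` is the Fourier integral of `cφ`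
  have hw : w = hmem.toLp cφ := Lp.ext (h1.trans hmem.coeFn_toLp.symm)
  have hFw : ((𝓕 w : Lp ℂ 2 (volume : Measure ℝ)) : ℝ → ℂ) =ᵐ[volume] 𝓕 cφ := by
    rw [hw]
    exact Literature.Analysis.FunctionSpaces.fourier_toLp_ae_eq_fourierIntegral hint hmem
  -- (4) `w` is even: `𝐏₀₁ w = P̂ w` and `𝓕 (P̂ w) = P (𝓕 w)`
  have hw_even : w ∈ evenPart := soninSpace_le_evenPart 1 0 (soninProjection_mem 1 0 _)
  have h01 : soninProjection 0 1 w = outerProjHat w := soninProjection_zero_one_eq_outerProjHat hw_even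
  have hFP : (𝓕 (outerProjHat w) : Lp ℂ 2 (volume : Measure ℝ))
      = outerProj (𝓕 w : Lp ℂ 2 (volume : Measure ℝ)) := by
    rw [outerProjHat_apply, outerProj_apply, cutoffProjHat_apply]
    change Lp.fourierTransformₗᵢ ℝ ℂ (w - (Lp.fourierTransformₗᵢ ℝ ℂ).symm
      (cutoffProj 1 (Lp.fourierTransformₗᵢ ℝ ℂ w))) = _
    rw [map_sub, LinearIsometryEquiv.apply_symm_apply]
    rfl
  -- (5) pointwise assembly
  rw [h01, hFP]
  have hB4 := fourierIntegral_column_eq hg hgs hφc hφs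
  filter_upwards [outerProj_coeFn (𝓕 w : Lp ℂ 2 (volume : Measure ℝ)), hFw] with ξ hξ1 hξ2
  rw [hξ1, cutoffP]
  by_cases hξ : 1 ≤ |ξ|
  · rw [if_pos hξ, hξ2, Real.fourier_real_eq_integral_exp_smul]
    simp only [smul_eq_mul, cutoffScalingKernel_of_le hξ]
    exact hB4 ξ
  · rw [if_neg hξ]
    simp only [cutoffScalingKernel_of_lt (not_le.mp hξ), zero_mul, integral_zero]


/-- **`T_g = 𝓕 𝐏₀₁ 𝐏₁₀ ϑ(g)` acts by the kernel `k_g` on all of `L²(ℝ)`, as soon as `k_g ∈ L²(ℝ²)`**: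
both `T_g` and the `L²`-kernel operator of `k_g` (Reed–Simon VI.23, `L2Kernel.exists_op`) are bounded
and agree on the dense subspace `C_c(ℝ)` (`MemLp.exists_hasCompactSupport_eLpNorm_sub_le`).
[cite: ConnesConsani2021, §2 Prop. 2.2 (iii) proof p. 10 (chunk p0010:L28–L40)] [cite: ReedSimon1972, Thm. VI.23, PDF pp. 198–199] -/
theorem fourier_cutoffs_scalingOp_coeFn (hg : Continuous g) (hgs : HasCompactSupport g)
    (hk : MemLp (uncurry (cutoffScalingKernel g)) 2 ((volume : Measure ℝ).prod volume))
    (φ : Lp ℂ 2 (volume : Measure ℝ)) :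
    ((𝓕 (soninProjection 0 1 (soninProjection 1 0 (scalingOp g φ))) : Lp ℂ 2 (volume : Measure ℝ)) :
        ℝ → ℂ) =ᵐ[volume] fun ξ => ∫ y, cutoffScalingKernel g ξ y * φ y := by
  obtain ⟨A, hA⟩ := L2Kernel.exists_op (μ := (volume : Measure ℝ)) (ν := (volume : Measure ℝ)) hk
  set S : Lp ℂ 2 (volume : Measure ℝ) →L[ℂ] Lp ℂ 2 (volume : Measure ℝ) :=
    (Lp.fourierTransformₗᵢ ℝ ℂ).toLinearIsometry.toContinuousLinearMap ∘L soninProjection 0 1 ∘L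
      soninProjection 1 0 ∘L scalingOp g with hS
  have hSapply : ∀ u : Lp ℂ 2 (volume : Measure ℝ),
      S u = (𝓕 (soninProjection 0 1 (soninProjection 1 0 (scalingOp g u))) :
        Lp ℂ 2 (volume : Measure ℝ)) := fun u => rfl
  -- `S = A` on continuous compactly supported functions
  have hSA : ∀ {φ₀ : ℝ → ℂ} (hφc : Continuous φ₀) (hφs : HasCompactSupport φ₀),
      S ((hφc.memLp_of_hasCompactSupport (μ := (volume : Measure ℝ)) (p := 2) hφs).toLp φ₀)
        = A ((hφc.memLp_of_hasCompactSupport (μ := (volume : Measure ℝ)) (p := 2) hφs).toLp φ₀) := by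
    intro φ₀ hφc hφs
    apply Lp.ext
    have hmem := hφc.memLp_of_hasCompactSupport (μ := (volume : Measure ℝ)) (p := 2) hφs
    have h1 := fourier_cutoffs_scalingOp_toLp_coeFn hg hgs hφc hφs
    have h2 := hA (hmem.toLp φ₀)
    have h3 : ∀ ξ, ∫ y, cutoffScalingKernel g ξ y * (hmem.toLp φ₀ : ℝ → ℂ) y
        = ∫ y, cutoffScalingKernel g ξ y * φ₀ y := fun ξ =>
      integral_congr_ae (by filter_upwards [hmem.coeFn_toLp] with y hy; rw [hy])
    rw [hSapply]
    filter_upwards [h1, h2] with ξ hξ1 hξ2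
    rw [hξ1, hξ2, h3]
  -- `S = A` by density of `C_c(ℝ)` in `L²(ℝ)`
  have hSA' : ∀ u : Lp ℂ 2 (volume : Measure ℝ), S u = A u := by
    intro u
    rw [← sub_eq_zero, ← sub_apply, ← norm_le_zero_iff]
    refine le_of_forall_pos_le_add fun ε hε => ?_
    rw [zero_add]
    set D := S - A with hD
    -- approximate `u` by a continuous compactly supported function
    have hδ : (0 : ℝ) < ε / (‖D‖ + 1) := div_pos hε (by positivity)
    obtain ⟨φ₀, hφs, hφε, hφc, hφmem⟩ := (Lp.memLp u).exists_hasCompactSupport_eLpNorm_sub_le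
      ENNReal.ofNat_ne_top (ε := ENNReal.ofReal (ε / (‖D‖ + 1))) (by simpa using hδ)
    have hmem := hφc.memLp_of_hasCompactSupport (μ := (volume : Measure ℝ)) (p := 2) hφs
    have hdist : ‖u - hmem.toLp φ₀‖ ≤ ε / (‖D‖ + 1) := by
      rw [Lp.norm_def]
      have hcongr : eLpNorm ((u - hmem.toLp φ₀ : Lp ℂ 2 (volume : Measure ℝ)) : ℝ → ℂ) 2 volume
          = eLpNorm ((u : ℝ → ℂ) - φ₀) 2 volume :=
        eLpNorm_congr_ae (by
          filter_upwards [Lp.coeFn_sub u (hmem.toLp φ₀), hmem.coeFn_toLp] with x hx hx'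
          rw [hx, Pi.sub_apply, hx', Pi.sub_apply])
      rw [hcongr]
      exact ENNReal.toReal_le_of_le_ofReal hδ.le hφε
    have hDφ : D (hmem.toLp φ₀) = 0 := by
      rw [hD, sub_apply, sub_eq_zero]
      exact hSA hφc hφs
    calc ‖D u‖ = ‖D (u - hmem.toLp φ₀)‖ := by rw [map_sub, hDφ, sub_zero]
      _ ≤ ‖D‖ * ‖u - hmem.toLp φ₀‖ := D.le_opNorm _
      _ ≤ ‖D‖ * (ε / (‖D‖ + 1)) := by gcongr
      _ ≤ (‖D‖ + 1) * (ε / (‖D‖ + 1)) := by gcongr; linarith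
      _ = ε := by field_simp
  rw [← hSapply, hSA' φ]
  exact hA φ

/-! ## `CC2021_prop_2_2_iii` from the kernel-energy identity -/

/-- **Prop. 2.2 (iii) from ONE kernel-energy identity.**  If for every test function `g` the kernel
`k_g` of `T_g = 𝓕 P̂Pϑ(g)` is square integrable with `∫∫ |k_g(ξ, y)|² dy dξ = Re L(g ∗ g*)`
(`traceL = archW + remainderD`), then `CC2021_prop_2_2_iii` holds: by the operator half
(`prop_2_2_iii_of_l2Kernel`, isometry `U = 𝓕`) and `fourier_cutoffs_scalingOp_coeFn`.  The hypothesis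
is the content of the printed proof (kernels of `(1 − P)(u^g)P`, the square `Δ`, Weil's principal value),
delivered by the cell's `CosineTailEnergy` module; it is a hypothesis here, not a named fact.
[cite: ConnesConsani2021, §2 Prop. 2.2 (iii) statement and proof p. 10 (chunk p0010:L20–L75)] [cite: ReedSimon1972, Thm. VI.23, PDF pp. 198–199] -/
theorem CC2021_prop_2_2_iii_of_kernel_energy
    (H : ∀ g : ℝ → ℂ, IsWeilTest g →
      MemLp (uncurry (cutoffScalingKernel g)) 2 ((volume : Measure ℝ).prod volume) ∧
      ∫ ξ, ∫ y, ‖cutoffScalingKernel g ξ y‖ ^ 2 = (traceL (weilConv g (weilReflect g))).re) :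
    CC2021_prop_2_2_iii := by
  refine prop_2_2_iii_of_l2Kernel fun g hg => ?_
  obtain ⟨hk, hval⟩ := H g hg
  exact ⟨ℝ, inferInstance, volume, inferInstance, (Lp.fourierTransformₗᵢ ℝ ℂ).toLinearIsometry,
    cutoffScalingKernel g, hk, fun φ => fourier_cutoffs_scalingOp_coeFn hg.1.continuous hg.2 hk φ, hval⟩


end Literature.NumberTheory.ConnesConsani2021

end
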